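import Summits.QuantumFields.BalabanUV.Beta.FP.TowerDoorGaugeRefDefsG
import Summits.QuantumFields.BalabanUV.Beta.FP.TowerDoorGaugeLatticeSum

/-!
# `BalabanUV.Beta.FP.TowerDoorGaugeLatticeSumG` — row D1 ∕ (C1) OWNER «beta-an2», PART 84, ROUTE T (β1), v11 (R-root): **PART 58 `TowerDoorGaugeLatticeSum` OVER `Q`, (TB) DISPLAYED** —
# the joint block covariance of `lamZG Lc Q …` and LEMMA U ON THE LATTICE (`Σ'_z λℤ_(μ,z)(u) = 0`: the source sum of the reference columns is the face field, which the reference nested slice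
# KILLS — PART 53's U2 `nestedRows_mulVec_eq_zero_of_faceSupported Lc Q hQ …` at the reference tower, its two-block letter (TB) now a displayed hypothesis `hQ` on `Q` instead of road (B)
# `QSym_twoBlock`), and the record's chart instance; PART 58 line for line (`tsum_scaleK_AN_sources_eq_zero_of_quo_eq` is row-free and REUSED by name)
# (β-function cell `pub-balaban`, BINDER-OWNERS row D1; FINDING AN2-82-1, road A-4 l.69064)

WHY (located).  (TB) is the one row-family fact LEMMA U spends; at the sym record it is `QSym_twoBlock`, at the rooted record PART 80 `QCtr_twoBlock` — the consumer (PART 69′ ∕ R4b′ ∕ 77′)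
discharges it at its instance.

WHAT ([folklore] BY NAME; no `def`, no `def … : Prop`, nothing cited, 0 sorry): §1 `lamZG_translate` (road (C1) `quo_add_zsmul`), `hasSum_lamZG_sources ∕ tsum_lamZG_sources` (under `hQ`);
§2 the record's chart: `hasSum_lamZG_sources_record ∕ tsum_lamZG_sources_record` (under `hQ`; PART 52's summability + the face read-out).
WHAT THIS IS NOT: nothing of v10 ∕ the END of record moves; nothing of Bałaban's asserted, valued or discharged; 0 estimates; 0∕4 row-D1 binders (hW, hR, D1Tel, D1Rep);
ROOT M‴ p325680 ∕ P5c ∕ D6 untouched; NOT (C1), NOT (T-ID), NOT D1, NEVER «G-an2-4 closed», NOT BetaPertH, NOT continuum, NOT Clay.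


HONEST DEPENDENCY (page 1, mandatory): continuum YM on T⁴ ⇐ BetaPertH ∧ nine spine estimates (0/9 proved); BetaPertH ⇐ (D1) ∧ (D4) ∧ CAP+tail;
G-an2-4 gates asym, D1 and NE2/3/4.  HONEST FRAMING (cell contract, verbatim): «discharging `BetaPertH` makes Bałaban's UV stability UNCONDITIONAL —
a real constructive-QFT result; it is NOT the continuum limit and NOT the Clay problem.»  ABSOLUTE RULE (cell charter, verbatim): «No internally-minted
statement may enter as a cited fact. Every hypothesis is either kernel-proved in this package or a verbatim quotation of a PUBLISHED theorem with page
reference. The manuscript(s) under audit are NOT citable for their own disputed steps — they are the thing under adjudication; programme-internal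
(2001/route/tribunal) claims are never citable.»  Row D1 ∕ (C1) OWNER «beta-an2», b2b-balaban-beta-an2 gen 82, 2026-08-29.  No existing file touched.
-/

noncomputable section

open Finset Matrix
open scoped BigOperators
open Literature.MathematicalPhysics.QuantumFieldTheory
open Literature.MathematicalPhysics.QuantumFieldTheory.Balaban1983to89
open Literature.MathematicalPhysics.QuantumFieldTheory.Balaban1983to89.Beta
open B5Prop11Plancherel (fine)
open B6Lemma24Torus (pbox)
open AffineAveraging (Site box toSite unitVec)
open AveragingContoursRooted (ctrOff ctrOff_mem_box)
open OneStepResolventKernel (Fib)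
open ExpKernelCalculus (MKer)
open HessKerRate (scaleK)
open Literature.MathematicalPhysics.QuantumFieldTheory.LatticeForm (quo)
open Summit.QuantumFields.BalabanUV.Beta.CompositeOneShotJetData (Roots AN)
open Summit.QuantumFields.BalabanUV.Beta.FP.TorusCombRows (Res)
open Summit.QuantumFields.BalabanUV.Beta.FP.TorusCompositeObjects (towerTorus NParam combF bigP towerGen bigRoot bigRatio bigRatio_eq_pow bigRatio_pos towerEquiv)
open Summit.QuantumFields.BalabanUV.Beta.FP.TorusCompositeObjectsG (StepRows compRowsG)
open Summit.QuantumFields.BalabanUV.Beta.FP.TorusCompositeUnimodular (towerEvalC)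
open Summit.QuantumFields.BalabanUV.Beta.FP.TorusCombTranslate (quo_add_zsmul)
open Summit.QuantumFields.BalabanUV.Beta.FP.TorusReferenceBlock (sub_zsmul_quo_mem_pbox_ref)
open Summit.QuantumFields.BalabanUV.Beta.FP.TowerDoorUniformDataTorus (summable_scaleK_AN_inl_inr_sources tsum_scaleK_AN_inl_inr_sources_eq)
open Summit.QuantumFields.BalabanUV.Beta.FP.TowerDoorUniformDataNested (nestedRows_mulVec_eq_zero_of_faceSupported faceField_faceSupported)
open Summit.QuantumFields.BalabanUV.Beta.FP.TowerDoorGaugeRefDefs (refCol refCol_apply)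
open Summit.QuantumFields.BalabanUV.Beta.FP.TowerDoorGaugeRefDefsG
open Summit.QuantumFields.BalabanUV.Beta.FP.TowerDoorGaugeCopies (hasSum_mulVec hasSum_readout)
open Summit.QuantumFields.BalabanUV.Beta.FP.TowerDoorGaugeLatticeSum (tsum_scaleK_AN_sources_eq_zero_of_quo_eq)

namespace Summit.QuantumFields.BalabanUV.Beta.FP.TowerDoorGaugeLatticeSumG

variable {d : ℕ}


/-! ## §1 Over `Q`, kernel-generic: joint block covariance; the source sum of `λℤ` vanishes -/

section Generic

variable (Lc : ℕ) [NeZero Lc] (Q : StepRows d Lc)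
  (hQ : ∀ (M : Fin (d + 1) → ℕ) [∀ μ, NeZero (M μ)] (ℓ : ℕ) (r : Fin (d + 1) → ℕ) (a : ↥(pbox M)) (ν : Fin (d + 1))
      (b : ↥(pbox (fine Lc M))) (κ : Fin (d + 1)),
      (a : Site (d + 1)) + unitVec ν ∈ pbox M → Q M ℓ r (a, ν) (b, κ) ≠ 0 →
        (quo Lc (b : Site (d + 1)) = a ∨ quo Lc (b : Site (d + 1)) = (a : Site (d + 1)) + unitVec ν) ∧
        (quo Lc ((b : Site (d + 1)) + unitVec κ) = a ∨ quo Lc ((b : Site (d + 1)) + unitVec κ) = (a : Site (d + 1)) + unitVec ν))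
  (lev : ℕ → ℕ) (rs : ℕ → (Fin (d + 1) → ℕ))
  (hrs : ∀ k i, 0 ≤ toSite (rs k) i ∧ toSite (rs k) i < (Lc : ℤ)) (n : ℕ) (A : MKer (d + 1) (Fib d))

/-- [folklore] **`lamZG_translate` — JOINT `L`-BLOCK COVARIANCE OF THE LATTICE GAUGE FUNCTION**: `lamZ … μ (z + t) (u + L•t) = lamZ … μ z u` (the representative of `u + L•t` is that of `u`, the source
moves with the block: road (C1) `quo_add_zsmul`). -/
theorem lamZG_translate (μ : Fin (d + 1)) (z u t : Site (d + 1)) :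
    lamZG Lc Q lev rs hrs n A μ (z + t) (u + ((bigRatio Lc (n + 1) : ℕ) : ℤ) • t) = lamZG Lc Q lev rs hrs n A μ z u := by
  have hL : 0 < bigRatio Lc (n + 1) := bigRatio_pos Lc (Nat.pos_of_ne_zero (NeZero.ne Lc)) (n + 1)
  have hq : quo (bigRatio Lc (n + 1)) (u + ((bigRatio Lc (n + 1) : ℕ) : ℤ) • t) = quo (bigRatio Lc (n + 1)) u + t := quo_add_zsmul hL u t
  have hrep : (⟨u + ((bigRatio Lc (n + 1) : ℕ) : ℤ) • t + ((bigRatio Lc (n + 1) : ℕ) : ℤ) • (-quo (bigRatio Lc (n + 1)) (u + ((bigRatio Lc (n + 1) : ℕ) : ℤ) • t)),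
        sub_zsmul_quo_mem_pbox_ref Lc n (u + ((bigRatio Lc (n + 1) : ℕ) : ℤ) • t)⟩ : ↥(pbox (towerTorus Lc (fun _ : Fin (d + 1) => Lc) (n + 1))))
      = ⟨u + ((bigRatio Lc (n + 1) : ℕ) : ℤ) • (-quo (bigRatio Lc (n + 1)) u), sub_zsmul_quo_mem_pbox_ref Lc n u⟩ := by
    apply Subtype.ext
    simp only [hq, neg_add, smul_add, smul_neg]
    abel
  rw [lamZG_eq, lamZG_eq, hrep, hq, show z + t - (quo (bigRatio Lc (n + 1)) u + t) = z - quo (bigRatio Lc (n + 1)) u by abel]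

include hQ

/-- [folklore] **`hasSum_lamZG_sources` — LEMMA U ON THE LATTICE, KERNEL-GENERIC, NO INVERTIBILITY**: if the sublattice field–multiplier columns `z ↦ A x (L•z) (inl κ) (inr μ)` are summable and their
source sums VANISH on every bond whose two endpoints share their `L`-block (the face-field property of U1), then `HasSum (z ↦ lamZG Lc Q lev rs hrs n A μ z u) 0` for every lattice site `u`:
the source sum of the reference columns is face-supported, the reference nested slice kills it (PART 53 U2 at `fun _ => Lc` over road (B)'s (TB)), and `−(N·W₀)⁻¹·N`, `towerEvalC`, the read-out are
finite linear maps (PART 56 §1). -/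
theorem hasSum_lamZG_sources (μ : Fin (d + 1))
    (hAs : ∀ (x : Site (d + 1)) (κ : Fin (d + 1)), Summable (fun z : Site (d + 1) => A x (((bigRatio Lc (n + 1) : ℕ) : ℤ) • z) (Sum.inl κ) (Sum.inr μ)))
    (hface : ∀ (x : Site (d + 1)) (κ : Fin (d + 1)), quo (bigRatio Lc (n + 1)) x = quo (bigRatio Lc (n + 1)) (x + unitVec κ) →
      (∑' z : Site (d + 1), A x (((bigRatio Lc (n + 1) : ℕ) : ℤ) • z) (Sum.inl κ) (Sum.inr μ)) = 0)
    (u : Site (d + 1)) :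
    HasSum (fun z : Site (d + 1) => lamZG Lc Q lev rs hrs n A μ z u) 0 := by
  set q : Site (d + 1) := quo (bigRatio Lc (n + 1)) u with hq
  -- the source sum of the reference columns, coordinatewise
  set X : ↥(pbox (towerTorus Lc (fun _ : Fin (d + 1) => Lc) (n + 1))) × Fin (d + 1) → ℝ := fun b =>
    ∑' z : Site (d + 1), A (b.1 : Site (d + 1)) (((bigRatio Lc (n + 1) : ℕ) : ℤ) • z) (Sum.inl b.2) (Sum.inr μ) with hX
  have hcol : HasSum (fun z : Site (d + 1) => refCol Lc n A μ z) X := by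
    rw [Pi.hasSum]
    intro b
    exact (hAs (b.1 : Site (d + 1)) b.2).hasSum
  -- the reference nested slice kills it (U2 at the reference tower)
  have hNX : refSliceG Lc Q lev rs hrs n *ᵥ X = 0 :=
    nestedRows_mulVec_eq_zero_of_faceSupported Lc Q hQ (fun _ : Fin (d + 1) => Lc) lev rs hrs (fun _ => dvd_rfl) n
      rfl rfl rfl (refSliceG_eq Lc Q lev rs hrs n) (fun b hb => hface (b.1 : Site (d + 1)) b.2 hb)
  -- hence the gauge parameters sum to `0`, and so do their read-outs
  have hθ : HasSum (fun z : Site (d + 1) => refThetaG Lc Q lev rs hrs n A μ z) 0 := by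
    have h := (hasSum_mulVec (refSliceG Lc Q lev rs hrs n * towerGen Lc (fun _ : Fin (d + 1) => Lc) rs (n + 1))⁻¹
      (hasSum_mulVec (refSliceG Lc Q lev rs hrs n) hcol)).neg
    rw [hNX, Matrix.mulVec_zero, neg_zero] at h
    exact h
  have hr := hasSum_readout (towerEvalC Lc (fun _ : Fin (d + 1) => Lc) rs hrs (n + 1))
    (fun x : Res (bigRoot Lc rs (n + 1)) (bigRatio Lc (n + 1)) (towerTorus Lc (fun _ : Fin (d + 1) => Lc) (n + 1)) =>
      (x.1 : ↥(pbox (towerTorus Lc (fun _ : Fin (d + 1) => Lc) (n + 1)))))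
    (towerEquiv Lc (fun _ : Fin (d + 1) => Lc) rs hrs (n + 1))
    (⟨u + ((bigRatio Lc (n + 1) : ℕ) : ℤ) • (-q), sub_zsmul_quo_mem_pbox_ref Lc n u⟩ : ↥(pbox (towerTorus Lc (fun _ : Fin (d + 1) => Lc) (n + 1)))) hθ
  rw [Matrix.mulVec_zero] at hr
  simp only [Pi.zero_apply, ite_self, Finset.sum_const_zero] at hr
  -- re-index the sources by the block of `u`
  have e : (fun z : Site (d + 1) => lamZG Lc Q lev rs hrs n A μ z u)
      = (fun z : Site (d + 1) => -(∑ x : Res (bigRoot Lc rs (n + 1)) (bigRatio Lc (n + 1)) (towerTorus Lc (fun _ : Fin (d + 1) => Lc) (n + 1)),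
          (if (x.1 : ↥(pbox (towerTorus Lc (fun _ : Fin (d + 1) => Lc) (n + 1)))) = ⟨u + ((bigRatio Lc (n + 1) : ℕ) : ℤ) • (-q), sub_zsmul_quo_mem_pbox_ref Lc n u⟩
            then (towerEvalC Lc (fun _ : Fin (d + 1) => Lc) rs hrs (n + 1) *ᵥ refThetaG Lc Q lev rs hrs n A μ z) (towerEquiv Lc (fun _ : Fin (d + 1) => Lc) rs hrs (n + 1) x) else 0)))
        ∘ (Equiv.subRight q) := by
    funext z
    simp only [Function.comp_apply, Equiv.subRight_apply, lamZG_eq, hq]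
  rw [e, (Equiv.subRight q).hasSum_iff]
  simpa using hr.neg

/-- [folklore] … hence `Σ'_z lamZ … μ z u = 0`. -/
theorem tsum_lamZG_sources (μ : Fin (d + 1))
    (hAs : ∀ (x : Site (d + 1)) (κ : Fin (d + 1)), Summable (fun z : Site (d + 1) => A x (((bigRatio Lc (n + 1) : ℕ) : ℤ) • z) (Sum.inl κ) (Sum.inr μ)))
    (hface : ∀ (x : Site (d + 1)) (κ : Fin (d + 1)), quo (bigRatio Lc (n + 1)) x = quo (bigRatio Lc (n + 1)) (x + unitVec κ) →
      (∑' z : Site (d + 1), A x (((bigRatio Lc (n + 1) : ℕ) : ℤ) • z) (Sum.inl κ) (Sum.inr μ)) = 0)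
    (u : Site (d + 1)) :
    (∑' z : Site (d + 1), lamZG Lc Q lev rs hrs n A μ z u) = 0 :=
  (hasSum_lamZG_sources Lc Q hQ lev rs hrs n A μ hAs hface u).tsum_eq

end Generic

/-! ## §2 At the record's chart `σ·AN·σ`: the hypotheses are PART 52's summability and the face read-out -/

section Record

variable {Lc : ℕ} [NeZero Lc] (Q : StepRows 3 Lc)
  (hQ : ∀ (M : Fin (3 + 1) → ℕ) [∀ μ, NeZero (M μ)] (ℓ : ℕ) (r : Fin (3 + 1) → ℕ) (a : ↥(pbox M)) (ν : Fin (3 + 1))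
      (b : ↥(pbox (fine Lc M))) (κ : Fin (3 + 1)),
      (a : Site (3 + 1)) + unitVec ν ∈ pbox M → Q M ℓ r (a, ν) (b, κ) ≠ 0 →
        (quo Lc (b : Site (3 + 1)) = a ∨ quo Lc (b : Site (3 + 1)) = (a : Site (3 + 1)) + unitVec ν) ∧
        (quo Lc ((b : Site (3 + 1)) + unitVec κ) = a ∨ quo Lc ((b : Site (3 + 1)) + unitVec κ) = (a : Site (3 + 1)) + unitVec ν))
  (R : Roots Lc) (lev : ℕ → ℕ) (rs : ℕ → (Fin (3 + 1) → ℕ))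
  (hrs : ∀ k i, 0 ≤ toSite (rs k) i ∧ toSite (rs k) i < (Lc : ℤ)) (n : ℕ) (σ : Fib 3 → ℝ)
include hQ

/-- [folklore] **`hasSum_lamZG_sources_record` — LEMMA U ON THE LATTICE FOR THE RECORD's CHART**: `HasSum (z ↦ lamZG Lc Q lev rs hrs n (scaleK σ σ (AN R (n+1))) μ z u) 0` for every lattice site `u`,
every root list, unconditionally (PART 52's summability + the face read-out feed §1). -/
theorem hasSum_lamZG_sources_record (μ : Fin (3 + 1)) (u : Site (3 + 1)) :
    HasSum (fun z : Site (3 + 1) => lamZG Lc Q lev rs hrs n (scaleK σ σ (AN R (n + 1))) μ z u) 0 :=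
  hasSum_lamZG_sources Lc Q hQ lev rs hrs n (scaleK σ σ (AN R (n + 1))) μ
    (fun x κ => by rw [bigRatio_eq_pow]; exact summable_scaleK_AN_inl_inr_sources R (n + 1) σ σ x κ μ)
    (fun x κ h => tsum_scaleK_AN_sources_eq_zero_of_quo_eq R n σ x κ μ h) u

/-- [folklore] **`tsum_lamZG_sources_record`**: `Σ'_z lamZG Lc Q lev rs hrs n (scaleK σ σ (AN R (n+1))) μ z u = 0` — K2L-LAM's «Λ_μ constant» ON THE LATTICE, the constant being `0`. -/
theorem tsum_lamZG_sources_record (μ : Fin (3 + 1)) (u : Site (3 + 1)) :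
    (∑' z : Site (3 + 1), lamZG Lc Q lev rs hrs n (scaleK σ σ (AN R (n + 1))) μ z u) = 0 :=
  (hasSum_lamZG_sources_record Q hQ R lev rs hrs n σ μ u).tsum_eq

end Record

end Summit.QuantumFields.BalabanUV.Beta.FP.TowerDoorGaugeLatticeSumG

end
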